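import Summits.ResolutionOfSingularities.ResolutionOfSingularities.Theorems.WeightedInvariantLocalWeightedDropTrackCDefs
import Literature.AlgebraicGeometry.Resolution.EmbeddedResolutionExcellentSurfacesSequence
import Literature.AlgebraicGeometry.Resolution.BlowupsIntegral
import Literature.AlgebraicGeometry.Resolution.BlowupsProperProofs
import Literature.AlgebraicGeometry.Resolution.BlowupStalkEmbedding
import Literature.AlgebraicGeometry.Resolution.MarkedIdealsLemmas
import Literature.AlgebraicGeometry.Resolution.AdicNoetherian

/-!
# Track C: invariants carried FORWARD along a `𝓑`-permissible sequence

[OURS · L1 W4.3 · chain w43, stub worker 4] Helper for TRACK C of the engine crux `LocalWeightedDrop`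
(stmt-ResolutionOfSingularities-8899; skeleton `L/res-L1-w43-stub-4/TrackC_Skeleton.lean`). NOT a statement of any
manuscript.

Along a `𝓑`-permissible sequence `σ : Z' ⟶ Z` (`IsBPermissibleSequence`, Cossart–Jannsen–Saito (6.2)) starting from an
integral locally Noetherian `Z`: every centre is a NON-ZERO ideal sheaf (its support lies in the singular locus of the
strict transform, which misses the generic point), so by induction `Z'` is integral (`IsBlowup.isIntegral`) and locally
Noetherian (`IsBlowup.isProper`), and the stalk maps `𝒪_{Z,σ z} → 𝒪_{Z',z}` are injective
(`IsBlowup.stalkMap_injective`): `forward`. Consequences for Track C: the total transform of `f ≠ 0` is non-zero at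
every point (`totalGerm_ne_zero`), the strict transform stays closed (`isClosed_of_seq`), and a non-zero ideal sheaf
on an integral scheme has non-zero stalks (`stalkIdeal_ne_bot_of_ne_bot`).
-/

noncomputable section

open CategoryTheory AlgebraicGeometry TopologicalSpace IsLocalRing
open Literature.AlgebraicGeometry.Resolution
open Scheme.IdealSheafData

set_option linter.dupNamespace false -- mandated namespace of this single-conjunct summit

namespace Summit.ResolutionOfSingularities.ResolutionOfSingularities.Theorems.TrackC

/-- The stalk of the zero ideal sheaf is zero. [OURS · folklore] -/
theorem stalkIdeal_bot {X : Scheme.{0}} (x : X) : stalkIdeal (⊥ : X.IdealSheafData) x = ⊥ := by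
  obtain ⟨U, hU, hxU, -⟩ :=
    exists_isAffineOpen_mem_and_subset (X := X) (x := x) (U := ⊤) (Opens.mem_top x)
  rw [stalkIdeal_eq_map_germ _ ⟨U, hU⟩ hxU, Scheme.IdealSheafData.ideal_bot, Pi.bot_apply, Ideal.map_bot]

/-- **On an integral scheme a non-zero ideal sheaf has non-zero stalks** (sections embed into every stalk,
and an ideal sheaf vanishing at the generic point vanishes). [OURS · folklore] -/
theorem stalkIdeal_ne_bot_of_ne_bot {X : Scheme.{0}} [IsIntegral X] {C : X.IdealSheafData} (hC : C ≠ ⊥)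
    (x : X) : stalkIdeal C x ≠ ⊥ := by
  intro hx
  apply hC
  -- the sections of `C` over an affine open containing a point with zero stalk vanish
  have hsec : ∀ (U : X.affineOpens) (y : X) (hy : y ∈ (U : X.Opens)), stalkIdeal C y = ⊥ →
      C.ideal U = ⊥ := by
    intro U y hy h0
    rw [stalkIdeal_eq_map_germ C U hy] at h0
    refine le_bot_iff.mp fun s hs => ?_
    have h1 : (X.presheaf.germ U y hy).hom s ∈ (⊥ : Ideal _) := h0 ▸ Ideal.mem_map_of_mem _ hs
    exact (germ_injective_of_isIntegral (X := X) y hy) (by simpa using h1)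
  -- the stalk at the generic point vanishes
  have hξ : stalkIdeal C (genericPoint X) = ⊥ := by
    obtain ⟨U, hU, hxU, -⟩ :=
      exists_isAffineOpen_mem_and_subset (X := X) (x := x) (U := ⊤) (Opens.mem_top x)
    have hξU : genericPoint X ∈ U :=
      ((genericPoint_spec X).mem_open_set_iff U.isOpen).mpr ⟨x, Set.mem_univ _, hxU⟩
    rw [stalkIdeal_eq_map_germ C ⟨U, hU⟩ hξU, hsec ⟨U, hU⟩ x hxU hx, Ideal.map_bot]
  -- hence every stalk vanishes, and so does `C`
  refine le_bot_iff.mp (le_of_forall_stalkIdeal_le fun y => ?_)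
  obtain ⟨U, hU, hyU, -⟩ :=
    exists_isAffineOpen_mem_and_subset (X := X) (x := y) (U := ⊤) (Opens.mem_top y)
  have hξU : genericPoint X ∈ U :=
    ((genericPoint_spec X).mem_open_set_iff U.isOpen).mpr ⟨y, Set.mem_univ _, hyU⟩
  rw [stalkIdeal_eq_map_germ C ⟨U, hU⟩ hyU, hsec ⟨U, hU⟩ (genericPoint X) hξU hξ, Ideal.map_bot]
  exact bot_le

variable {Z : Scheme.{0}} {X B : Set Z}

/-- **A centre of a `𝓑`-permissible blow-up of an integral scheme is a non-zero ideal sheaf**: at the generic point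
the strict transform's ideal would vanish and the local ring — a field — would be regular, against `D ⊂ X_sing`.
[OURS · folklore] -/
theorem centre_ne_bot {Z' : Scheme.{0}} [IsIntegral Z'] {X' : Set Z'} (C : Z'.IdealSheafData)
    (hsub : vanishingIdeal ⟨closure X', isClosed_closure⟩ ≤ C)
    (hsing : ∀ x ∈ (C.support : Set Z'), ¬ IsRegularLocalRing
      ((Z'.presheaf.stalk x) ⧸ stalkIdeal (vanishingIdeal ⟨closure X', isClosed_closure⟩) x)) :
    C ≠ ⊥ := by
  intro hC
  have hξ : genericPoint Z' ∈ (C.support : Set Z') := by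
    rw [hC, Scheme.IdealSheafData.support_bot]; trivial
  apply hsing _ hξ
  have h2 : stalkIdeal (vanishingIdeal ⟨closure X', isClosed_closure⟩) (genericPoint Z') = ⊥ :=
    le_bot_iff.mp ((stalkIdeal_mono hsub _).trans (by rw [hC, stalkIdeal_bot]))
  rw [h2]
  haveI : IsRegularLocalRing (Z'.presheaf.stalk (genericPoint Z')) :=
    (inferInstance : IsRegularLocalRing Z'.functionField)
  exact IsRegularLocalRing.of_ringEquiv (RingEquiv.quotientBot _).symm

/-- **FORWARD invariants.** Along a `𝓑`-permissible sequence starting from an integral locally Noetherian scheme,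
the blown-up scheme is integral and locally Noetherian and all stalk maps of the composite are injective.
[OURS · folklore] -/
theorem forward [IsIntegral Z] [IsLocallyNoetherian Z] {Z' : Scheme.{0}} {σ : Z' ⟶ Z} {X' B' : Set Z'}
    (hseq : IsBPermissibleSequence X B σ X' B') :
    IsIntegral Z' ∧ IsLocallyNoetherian Z' ∧ ∀ z : Z', Function.Injective (σ.stalkMap z).hom := by
  induction hseq with
  | refl =>
    refine ⟨inferInstance, inferInstance, fun z => ?_⟩
    rw [Scheme.Hom.stalkMap_id]
    exact fun a b h => h
  | @blowup Z' Z'' σ X' B' h C τ hτ hreg hsub hsing hperm hnc ih =>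
    obtain ⟨hint, hnoeth, hinj⟩ := ih
    have hC : C ≠ ⊥ := centre_ne_bot C hsub hsing
    haveI := hτ.isIntegral hC
    haveI := hτ.isProper
    haveI : IsLocallyNoetherian Z'' := LocallyOfFiniteType.isLocallyNoetherian τ
    refine ⟨inferInstance, inferInstance, fun z => ?_⟩
    rw [Scheme.Hom.stalkMap_comp]
    exact (hτ.stalkMap_injective z).comp (hinj (τ z))

/-- Along a `𝓑`-permissible sequence the strict transform of a closed set is closed. [OURS · folklore] -/
theorem isClosed_of_seq {Z' : Scheme.{0}} {σ : Z' ⟶ Z} {X' B' : Set Z'}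
    (hseq : IsBPermissibleSequence X B σ X' B') (hX : IsClosed X) : IsClosed X' := by
  induction hseq with
  | refl => exact hX
  | blowup => exact isClosed_closure

variable {k : Type} [Field k]

/-- **The total transform of `f ≠ 0` is non-zero at every point** of a `𝓑`-permissible sequence over
`Z₀ = Spec k⟦x₀,x₁,x₂⟧`. [OURS · folklore] -/
theorem totalGerm_ne_zero {X B : Set (Spec (.of (MvPowerSeries (Fin 3) k)))} {Z' : Scheme.{0}}
    {σ : Z' ⟶ Spec (.of (MvPowerSeries (Fin 3) k))} {X' B' : Set Z'}
    (hseq : IsBPermissibleSequence X B σ X' B') {f : MvPowerSeries (Fin 3) k} (hf : f ≠ 0) (z : Z') :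
    totalGerm σ z f ≠ 0 := by
  haveI : IsDomain (MvPowerSeries (Fin 3) k) := NoZeroDivisors.to_isDomain _
  haveI : IsNoetherianRing (MvPowerSeries (Fin 3) k) := isNoetherianRing_mvPowerSeries (Fin 3) (R := k)
  obtain ⟨-, -, hinj⟩ := forward hseq
  -- the total transform is the image of the germ of `f` under the (injective) stalk map
  have h1 : totalGerm σ z f = (σ.stalkMap z).hom
      (((Spec (.of (MvPowerSeries (Fin 3) k))).presheaf.germ ⊤ (σ z) trivial).hom
        ((Scheme.ΓSpecIso (.of (MvPowerSeries (Fin 3) k))).inv.hom f)) :=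
    (Scheme.Hom.germ_stalkMap_apply σ ⊤ z trivial _).symm
  rw [h1, map_ne_zero_iff _ (hinj z)]
  -- the germ of `f ≠ 0` at any point of `Spec` of a domain is non-zero
  letI : Algebra (MvPowerSeries (Fin 3) k) ((Spec (.of (MvPowerSeries (Fin 3) k))).presheaf.stalk (σ z)) :=
    StructureSheaf.stalkAlgebra (MvPowerSeries (Fin 3) k) (σ z)
  haveI : IsLocalization.AtPrime ((Spec (.of (MvPowerSeries (Fin 3) k))).presheaf.stalk (σ z))
      (σ z).asIdeal := StructureSheaf.IsLocalization.to_stalk (MvPowerSeries (Fin 3) k) (σ z)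
  change algebraMap (MvPowerSeries (Fin 3) k) _ f ≠ 0
  intro h0
  exact hf ((IsLocalization.to_map_eq_zero_iff _ (σ z).asIdeal.primeCompl_le_nonZeroDivisors).mp h0)

end Summit.ResolutionOfSingularities.ResolutionOfSingularities.Theorems.TrackC

end
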